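/-
Copyright: the b2b-balaban T⁴-continuum CRUX team, row NE7b OWNER lineage `t4-ne7b-p1` (gen 118). Project licence.
-/
import Summits.QuantumFields.BalabanUV.T4Continuum.Spine.NE7b.SupTorusBackgroundDerivative

/-!
# THE EFFECTIVE ACTION IS TWICE DIFFERENTIABLE AT EVERY BLOCK FIELD AND ITS HESSIAN KEEPS THE FLOOR: in the convex regime
# `u′ ≥ −λ`, `λ < min(2,a)`, for ANY background map `Φ` of (93) and EVERY coarse torus field `wt`, the next-scale action
# `W = S ∘ Φ` has a second derivative `H2` at `wt`, `H2 k k′ = S″(Φ wt)(Dt k, Dt k′)` on the fibre responses of (100)∕(101), and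
# `(min(2,a) − λ)·Σ_x (Dt k x)² ≤ H2 k k`, `(min(2,a) − λ)·(n+1)^d·Σ_y k y² ≤ H2 k k` — (90)∕(91)'s floor, there only on SBTL's small
# chart ball, now on the WHOLE coarse carrier; the same for lattice `φ⁴` with `g ≥ 0`, `−m < min(2,a)`
# (row NE7b, node U5c; (101) + HSAH + TEA + (90) + (89) BY NAME; [folklore])

Cell `pub-balaban`, sub-cell `t4`, spine estimate NE7b (`T4WeightBudget.RelWeightBound`; the cell's OWN estimate — NOT PRINTED in
[Bałaban 1983–89], NOT PROVED).  Crux-route work under `Spine/NE7b/` by the row OWNER (`t4-ne7b-p1` gen 118) under FREEZE (0)'s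
crux-prover clause, closing gen 117's located item (a); NOTHING of Bałaban's is named as a Lean object, valued or asserted; no
`T4Continuum/Support` leaf typed; no `def`, no notation; zero `sorry`.  Imports (BY NAME): the OWNER's (101)
`…SupTorusBackgroundDerivative` (`exists_hasFDerivAt_fibreCritical` ∕ `torus_background_hasFDerivAt`; through it (100)
`torus_response_pairing` ∕ `exists_clm_diag`, HSAH `hasFDerivAt_fderiv_comp_branch`, TEA `exists_clm_pairForm` ∕
`differentiableAt_action` ∕ `hasFDerivAt_fderiv_action`, (90) `hessianForm_floor_response` ∕ `hessianForm_floor`, (89)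
`torus_form_coercive` ∕ `blockVolume_mul_sum_sq_blockAvg_le`, (96) `exists_clm_blockLift`, INST `fderiv_action_torus_eq_zero`, TDF
`torus_operator_form_symm`, (93) `hasDerivAt_phiFour_potential`, (86) `hasDerivAt_phiFour`).

WHY (located).  HESS ∕ (90) ∕ (91) computed the Hessian of the torus effective action and its floor `(min(2,a) − λ)(n+1)^d` from
LETTERS — a response family `HasFDerivAt σt (Dt w′)` on a ball, supplied only by the sup road's chart (SBTL: small ball, two-sided
curvature).  (101) supplies the response family on the whole coarse carrier in the convex regime, so HSAH's graph formula runs at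
every `wt` with `s = univ`: `W″(wt) k k′ = S″(Φ wt)(Dt k, Dt k′)`, and the response floor `(γ − λ)·Σ(Dt k)²` with block Jensen
`(n+1)^d·Σ_y (Q′t h)² ≤ Σ_x h²` on the section `Q′t∘Dt = 1` gives the coarse floor.  With (94)∕(96) (secant ∕ gradient letters)
this closes the convexity column: the renormalisation step `S ↦ W` preserves strict convexity QUANTITATIVELY and `W` is `C¹` with a
second derivative everywhere — for every mesh, period and dimension, with no small-field condition.

WHAT IS PROVED ([folklore]):
* §1 (TEA's level, the regime of (101)) **`hessian_fibreCritical`** (`∃ D H2`: the two response letters, `HasFDerivAt Φ D w`,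
  `HasFDerivAt (fderiv (S ∘ Φ)) H2 w`, `H2 k k′ = Σ_x ((At(D k)) x + u′(Φ w x)·(D k) x)·(D k′) x`, symmetry of `H2`, the response
  floor `(γ − λ)·Σ_x (D k x)² ≤ H2 k k` and, under block Jensen `vol·Σ_y (Qt h)² ≤ Σ_x h²`, the coarse floor
  `(γ − λ)·(vol·Σ_y k y²) ≤ H2 k k`).
* §2 (the `Beta.Site` carriers, displayed actions; `u′ ≥ −λ` on `ℝ`, `λ < min(2,a)`) THE END
  **`torus_effectiveAction_hessian_global`** (ANY background map `Φ`, EVERY `wt`), `torus_exists_nextScale_operator` ∕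
  **`torus_hessian_nextScale_reading`** (`H2 k k′ = (n+1)^d·Σ_y (Mt k) y·k′ y`, `Mt k = Q′t((At + u′(Φ wt)·)(Dt k))` — HESS's
  next-scale operator form, now at every `wt`).
* §3 **`phiFour_effectiveAction_hessian_global`** (`u t = g t³ + m t`, `0 ≤ g`, `−m < min(2,a)`: floor `(min(2,a) + m)(n+1)^d`).

HONEST (what this is NOT).  HSAH's graph formula + (101) + (90)'s three-line floors, by name; a second derivative AT EVERY POINT, not
`C²` (continuity of `wt ↦ H2(wt)` needs continuity of `u′`), no upper bound on `H2` (one-sided curvature), constants OURS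
(`min(2,a)` from B6QGQLower276, not sharp); nothing about the measure ∕ the fluctuation integral (that is (31)∕(95)'s Brascamp–Lieb
road, which gives convexity of `−log ∫` but not this floor); cubic periods; scalar skeleton, hard constraint, not the covariant
operators ((A3), NC-NE7b-α UNRULED); nothing of Bałaban's.  BY-NAME EFFECT ON THE WALL: NONE.  NE7b NOT PRINTED ∕ NOT PROVED; spine
PROVED 0∕9; rung (B)+1 on a FINITE torus — NOT infinite volume, NOT the mass gap, NOT Clay.  HONEST DEPENDENCY: continuum YM on T⁴ ⇐
BetaPertH ∧ nine spine estimates (0∕9 proved); BetaPertH ⇐ (D1) ∧ (D4) ∧ CAP+tail; G-an2-4 gates asym, D1 and NE2∕3∕4.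
-/

set_option autoImplicit false

noncomputable section

namespace Summit.QuantumFields.BalabanUV.T4Continuum.NE7b.SupTorusEffectiveActionHessianGlobal

open Set Function Filter
open scoped ENNReal Topology
open Literature.MathematicalPhysics.QuantumFieldTheory.Balaban1983to89
open B6QGQLower276 (X blk B side AX)
open B5Hk103ScalarZd (nbhd)
open Beta (Site siteOf windowMap)
open HardStepActionHessian (hasFDerivAt_fderiv_comp_branch)
open SupTorusDirichletForm (torus_operator_form_symm)
open SupTorusDirichletFormCoercive (torus_form_coercive blockVolume_mul_sum_sq_blockAvg_le)
open SupTorusEffectiveAction (exists_clm_pairForm differentiableAt_action hasFDerivAt_fderiv_action)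
open SupTorusEffectiveActionInstance (fderiv_action_torus_eq_zero)
open SupTorusActionMinimiser (hasDerivAt_phiFour_potential)
open SupTorusEffectiveActionHessianFloor (hessianForm_floor_response hessianForm_floor)
open SupTorusEffectiveActionGradient (exists_clm_blockLift)
open SupTorusFibreResponse (torus_response_pairing exists_clm_diag)
open SupTorusBackgroundDerivative (exists_hasFDerivAt_fibreCritical torus_background_hasFDerivAt)
open SupPhiFourBackground (hasDerivAt_phiFour)

variable {d : ℕ}

/-! ## §1. TEA's level: the second derivative of the fibre minimum at every point, with its floors -/

section Generic

variable {ι κ : Type*} [Fintype ι] [Fintype κ]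

/-- **THE HESSIAN OF THE FIBRE MINIMUM EXISTS AT EVERY POINT AND KEEPS THE FLOOR** (symmetric `At` with a form floor `γ`, `v′ = u`,
`u′` a derivative of `u`, `u′ ≥ −λ`, `λ < γ`; `Qt` with a continuous linear right inverse `M` and the block Jensen letter
`vol·Σ_y (Qt h)² ≤ Σ_x h²`; `Φ` ANY map with `Qt(Φ w) = w` whose values are fibre-critical).  At EVERY `w`: `∃ D H2`, `Qt(D k) = k`,
`S″(Φ w)(D k, κ) = 0` on `ker Qt`, `HasFDerivAt Φ D w`, `HasFDerivAt (fderiv (S ∘ Φ)) H2 w`,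
`H2 k k′ = Σ_x ((At(D k)) x + u′(Φ w x)·(D k) x)·(D k′) x = H2 k′ k`, `(γ − λ)·Σ_x (D k x)² ≤ H2 k k`,
`(γ − λ)·(vol·Σ_y k y²) ≤ H2 k k`. [folklore] -/
theorem hessian_fibreCritical (At : (ι → ℝ) →L[ℝ] (ι → ℝ))
    (hAt : ∀ φ ψ : ι → ℝ, ∑ x, ψ x * At φ x = ∑ x, φ x * At ψ x) {γ : ℝ}
    (hγ : ∀ h : ι → ℝ, γ * ∑ x, h x ^ 2 ≤ ∑ x, h x * At h x) {v u u' : ℝ → ℝ} (hv : ∀ t, HasDerivAt v (u t) t)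
    (hu : ∀ t, HasDerivAt u (u' t) t) {lam : ℝ} (hu' : ∀ t, -lam ≤ u' t) (hγlam : lam < γ)
    (Qt : (ι → ℝ) →L[ℝ] (κ → ℝ)) (M : (κ → ℝ) →L[ℝ] (ι → ℝ)) (hM : ∀ k : κ → ℝ, Qt (M k) = k) {vol : ℝ}
    (hJ : ∀ h : ι → ℝ, vol * ∑ y, Qt h y ^ 2 ≤ ∑ x, h x ^ 2)
    (Φ : (κ → ℝ) → (ι → ℝ)) (hΦQ : ∀ w, Qt (Φ w) = w)
    (hΦcrit : ∀ (w : κ → ℝ) (h : ι → ℝ), Qt h = 0 →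
      fderiv ℝ (fun φ : ι → ℝ => (1 / 2 : ℝ) * ∑ x, φ x * At φ x + ∑ x, v (φ x)) (Φ w) h = 0)
    (w : κ → ℝ) :
    ∃ (D : (κ → ℝ) →L[ℝ] (ι → ℝ)) (H2 : (κ → ℝ) →L[ℝ] (κ → ℝ) →L[ℝ] ℝ),
      (∀ k : κ → ℝ, Qt (D k) = k) ∧
      (∀ (k : κ → ℝ) (κ' : ι → ℝ), Qt κ' = 0 → ∑ x, (At (D k) x + u' (Φ w x) * D k x) * κ' x = 0) ∧
      HasFDerivAt Φ D w ∧
      HasFDerivAt (fderiv ℝ ((fun φ : ι → ℝ => (1 / 2 : ℝ) * ∑ x, φ x * At φ x + ∑ x, v (φ x)) ∘ Φ)) H2 w ∧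
      (∀ k k' : κ → ℝ, H2 k k' = ∑ x, (At (D k) x + u' (Φ w x) * D k x) * D k' x) ∧
      (∀ k k' : κ → ℝ, H2 k k' = H2 k' k) ∧
      (∀ k : κ → ℝ, (γ - lam) * ∑ x, D k x ^ 2 ≤ H2 k k) ∧
      (∀ k : κ → ℝ, (γ - lam) * (vol * ∑ y, k y ^ 2) ≤ H2 k k) := by
  -- the response family of (101) at every point
  choose Df hDf using fun w' : κ → ℝ =>
    exists_hasFDerivAt_fibreCritical At hAt hγ hv hu hu' hγlam Qt M hM Φ hΦQ hΦcrit w'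
  obtain ⟨H, hH⟩ := exists_clm_pairForm At (fun x => u' (Φ w x))
  have hV2 : HasFDerivAt (fderiv ℝ (fun φ : ι → ℝ => (1 / 2 : ℝ) * ∑ x, φ x * At φ x + ∑ x, v (φ x))) H (Φ w) :=
    hasFDerivAt_fderiv_action At hAt hv hu (Φ w) hH
  have hmain := hasFDerivAt_fderiv_comp_branch Qt (V := fun φ : ι → ℝ => (1 / 2 : ℝ) * ∑ x, φ x * At φ x + ∑ x, v (φ x))
    (s := univ) (w := w) univ_mem (fun w' _ => (hDf w').2.2) (fun w' _ => (hDf w').1)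
    (fun w' _ => differentiableAt_action At hAt hv (Φ w')) (fun w' _ κ' hκ' => hΦcrit w' κ' hκ') hV2
  have happ : ∀ k k' : κ → ℝ, H.bilinearComp (Df w) (Df w) k k' = ∑ x, (At (Df w k) x + u' (Φ w x) * Df w k x) * Df w k' x :=
    fun k k' => by rw [ContinuousLinearMap.bilinearComp_apply, hH]
  refine ⟨Df w, H.bilinearComp (Df w) (Df w), (hDf w).1, (hDf w).2.1, (hDf w).2.2, hmain, happ, fun k k' => ?_, fun k => ?_,
    fun k => ?_⟩
  · -- symmetry from the symmetry of `At`
    rw [happ, happ]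
    have hsplit : ∀ a b : ι → ℝ, ∑ x, (At a x + u' (Φ w x) * a x) * b x = ∑ x, b x * At a x + ∑ x, u' (Φ w x) * a x * b x :=
      fun a b => by rw [← Finset.sum_add_distrib]; exact Finset.sum_congr rfl fun x _ => by ring
    rw [hsplit, hsplit, hAt (Df w k) (Df w k')]
    congr 1
    exact Finset.sum_congr rfl fun x _ => by ring
  · exact hessianForm_floor_response At hγ (fun x => hu' (Φ w x)) (Df w) hH k
  · exact hessianForm_floor At hγ (fun x => hu' (Φ w x)) hγlam.le (Df w) Qt (hDf w).1 hJ hH k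

end Generic

/-! ## §2. The torus: THE END -/

section Torus

variable (n : ℕ) (a : ℝ) (s : ℕ) [NeZero s]
  {Dop Aop : lp (fun _ : X d => ℝ) ∞ →L[ℝ] lp (fun _ : X d => ℝ) ∞}
  (hD : ∀ (f : lp (fun _ : X d => ℝ) ∞) (y : X d), Dop f y = (((n : ℝ) + 1) ^ d)⁻¹ * ∑ p ∈ B n y, f p)
  (hA : ∀ (f : lp (fun _ : X d => ℝ) ∞) (p : X d), Aop f p = ∑ r ∈ nbhd n p, AX n a p r * f r)
  {v u u' : ℝ → ℝ} (hv : ∀ t, HasDerivAt v (u t) t) (hu : ∀ t, HasDerivAt u (u' t) t)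
  {lam : ℝ} (hu' : ∀ t, -lam ≤ u' t) (hγ : lam < min 2 a)
  {Ef : (Site d ((n + 1) * s) → ℝ) →L[ℝ] lp (fun _ : X d => ℝ) ∞}
  (hEf : ∀ (g : Site d ((n + 1) * s) → ℝ) (q : X d), Ef g q = g (siteOf d ((n + 1) * s) q))
  {Rf : lp (fun _ : X d => ℝ) ∞ →L[ℝ] (Site d ((n + 1) * s) → ℝ)}
  (hRf : ∀ (h : lp (fun _ : X d => ℝ) ∞) (x : Site d ((n + 1) * s)), Rf h x = h (windowMap d ((n + 1) * s) x))
  {Rc : lp (fun _ : X d => ℝ) ∞ →L[ℝ] (Site d s → ℝ)}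
  (hRc : ∀ (h : lp (fun _ : X d => ℝ) ∞) (x : Site d s), Rc h x = h (windowMap d s x))

include hD hA hv hu hu' hγ hEf hRf hRc in
/-- **THE END: THE TORUS EFFECTIVE ACTION IS TWICE DIFFERENTIABLE AT EVERY BLOCK FIELD, HESSIAN = THE ACTION'S HESSIAN ON THE
RESPONSES, FLOOR `(min(2,a) − λ)(n+1)^d` — MESH- AND VOLUME-FREE, NO SMALL-FIELD CONDITION.**  `v′ = u`, `u′` a derivative of `u`,
`u′ ≥ −λ` on `ℝ`, `λ < min(2,a)`; `Φ` ANY background map (block means `Q′t(Φ w) = w` and the sitewise equation at every `w` — exists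
uniquely by (93)); `At = Rf∘Aop∘Ef`, `Q′t = Rc∘Dop∘Ef`.  At EVERY coarse torus field `wt`: `∃ Dt H2` with `Q′t(Dt k) = k`, the
linearised sitewise letter on the fibre, `HasFDerivAt Φ Dt wt`, `HasFDerivAt (fderiv (S ∘ Φ)) H2 wt`,
`H2 k k′ = Σ_x ((At(Dt k)) x + u′(Φ wt x)·(Dt k) x)·(Dt k′) x = H2 k′ k`, `(min(2,a) − λ)·Σ_x (Dt k x)² ≤ H2 k k` and
`(min(2,a) − λ)·((n+1)^d·Σ_y k y²) ≤ H2 k k`. [folklore] -/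
theorem torus_effectiveAction_hessian_global (Φ : (Site d s → ℝ) → (Site d ((n + 1) * s) → ℝ))
    (hΦQ : ∀ w : Site d s → ℝ, ((Rc.comp Dop).comp Ef) (Φ w) = w)
    (hΦeq : ∀ (w : Site d s → ℝ) (p : X d), Aop (Ef (Φ w)) p + u (Ef (Φ w) p)
      = (((n : ℝ) + 1) ^ d)⁻¹ * ∑ p' ∈ B n (blk n p), (Aop (Ef (Φ w)) p' + u (Ef (Φ w) p')))
    (wt : Site d s → ℝ) :
    ∃ (Dt : (Site d s → ℝ) →L[ℝ] (Site d ((n + 1) * s) → ℝ)) (H2 : (Site d s → ℝ) →L[ℝ] (Site d s → ℝ) →L[ℝ] ℝ),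
      (∀ k : Site d s → ℝ, ((Rc.comp Dop).comp Ef) (Dt k) = k) ∧
      (∀ (k : Site d s → ℝ) (κ' : Site d ((n + 1) * s) → ℝ), ((Rc.comp Dop).comp Ef) κ' = 0 →
        ∑ x, (((Rf.comp Aop).comp Ef) (Dt k) x + u' (Φ wt x) * Dt k x) * κ' x = 0) ∧
      HasFDerivAt Φ Dt wt ∧
      HasFDerivAt (fderiv ℝ ((fun φ : Site d ((n + 1) * s) → ℝ =>
          (1 / 2 : ℝ) * ∑ x, φ x * ((Rf.comp Aop).comp Ef) φ x + ∑ x, v (φ x)) ∘ Φ)) H2 wt ∧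
      (∀ k k' : Site d s → ℝ, H2 k k' = ∑ x, (((Rf.comp Aop).comp Ef) (Dt k) x + u' (Φ wt x) * Dt k x) * Dt k' x) ∧
      (∀ k k' : Site d s → ℝ, H2 k k' = H2 k' k) ∧
      (∀ k : Site d s → ℝ, (min 2 a - lam) * ∑ x, Dt k x ^ 2 ≤ H2 k k) ∧
      (∀ k : Site d s → ℝ, (min 2 a - lam) * (((n : ℝ) + 1) ^ d * ∑ y, k y ^ 2) ≤ H2 k k) := by
  obtain ⟨M, -, hM⟩ := exists_clm_blockLift n s hD hEf hRc
  exact hessian_fibreCritical ((Rf.comp Aop).comp Ef) (torus_operator_form_symm n a s hA hEf hRf)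
    (torus_form_coercive n a s hA hEf hRf) hv hu hu' hγ ((Rc.comp Dop).comp Ef) M hM
    (fun h => by simpa only [ContinuousLinearMap.comp_apply] using blockVolume_mul_sum_sq_blockAvg_le n s hD hEf hRc h) Φ hΦQ
    (fun w h hh => fderiv_action_torus_eq_zero n a s hD hA hEf hRf hRc hv (Φ w) (hΦeq w) h hh) wt

omit [NeZero s] in
/-- **THE NEXT-SCALE OPERATOR AS A MAP**: for any `At`, `Q′t`, `Dt` and weight `g` there is a continuous linear `Mt` with
`(Mt k) y = Q′t(x ↦ (At(Dt k)) x + g x·(Dt k) x) y`. [folklore] -/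
theorem torus_exists_nextScale_operator (At : (Site d ((n + 1) * s) → ℝ) →L[ℝ] (Site d ((n + 1) * s) → ℝ))
    (Qt : (Site d ((n + 1) * s) → ℝ) →L[ℝ] (Site d s → ℝ)) (Dt : (Site d s → ℝ) →L[ℝ] (Site d ((n + 1) * s) → ℝ))
    (g : Site d ((n + 1) * s) → ℝ) :
    ∃ Mt : (Site d s → ℝ) →L[ℝ] (Site d s → ℝ),
      ∀ (k : Site d s → ℝ) (y : Site d s), Mt k y = Qt (fun x => At (Dt k) x + g x * Dt k x) y := by
  obtain ⟨N, hN⟩ := exists_clm_diag g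
  refine ⟨Qt.comp ((At + N).comp Dt), fun k y => ?_⟩
  have hfun : (At + N) (Dt k) = fun x => At (Dt k) x + g x * Dt k x := by
    funext x
    rw [add_apply, Pi.add_apply, hN]
  rw [ContinuousLinearMap.comp_apply, ContinuousLinearMap.comp_apply, hfun]

include hD hEf hRc in
/-- **THE HESSIAN IN NEXT-SCALE OPERATOR FORM** (HESS's reading, now at every block field): if `H2 k k′ = Σ_x F_k x·(Dt k′) x` with
`F_k x = (At(Dt k)) x + u′(φ x)·(Dt k) x` killing the torus fibre for every `k`, `Q′t(Dt k′) = k′`, and `Mt` has the action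
`(Mt k) y = Q′t(F_k) y`, then `H2 k k′ = (n+1)^d·Σ_y (Mt k) y·k′ y`. [folklore] -/
theorem torus_hessian_nextScale_reading {At : (Site d ((n + 1) * s) → ℝ) →L[ℝ] (Site d ((n + 1) * s) → ℝ)} {u' : ℝ → ℝ}
    {φ : Site d ((n + 1) * s) → ℝ} {Dt : (Site d s → ℝ) →L[ℝ] (Site d ((n + 1) * s) → ℝ)}
    (hDQ : ∀ k : Site d s → ℝ, ((Rc.comp Dop).comp Ef) (Dt k) = k)
    (hDlin : ∀ (k : Site d s → ℝ) (κ' : Site d ((n + 1) * s) → ℝ), ((Rc.comp Dop).comp Ef) κ' = 0 →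
      ∑ x, (At (Dt k) x + u' (φ x) * Dt k x) * κ' x = 0)
    {H2 : (Site d s → ℝ) →L[ℝ] (Site d s → ℝ) →L[ℝ] ℝ}
    (hH2 : ∀ k k' : Site d s → ℝ, H2 k k' = ∑ x, (At (Dt k) x + u' (φ x) * Dt k x) * Dt k' x)
    {Mt : (Site d s → ℝ) →L[ℝ] (Site d s → ℝ)}
    (hMt : ∀ (k : Site d s → ℝ) (y : Site d s),
      Mt k y = ((Rc.comp Dop).comp Ef) (fun x => At (Dt k) x + u' (φ x) * Dt k x) y)
    (k k' : Site d s → ℝ) :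
    H2 k k' = ((n : ℝ) + 1) ^ d * ∑ y, Mt k y * k' y := by
  rw [hH2, torus_response_pairing n s hD hEf hRc hDlin hMt k (Dt k'), hDQ k']

end Torus

/-! ## §3. Lattice `φ⁴`: strict convexity of the next-scale action at every block field when `g ≥ 0`, `−m < min(2,a)` -/

/-- **THE `φ⁴_d` EFFECTIVE ACTION IS TWICE DIFFERENTIABLE AT EVERY BLOCK FIELD WITH HESSIAN FLOOR `(min(2,a) + m)(n+1)^d`**
(`u t = g t³ + m t`, `v t = (g∕4)t⁴ + (m∕2)t²`, `0 ≤ g`, `−m < min(2,a)`; every side `n + 1`, period `s ≥ 1`, dimension `d`; ANY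
operators ∕ carrier maps with the displayed actions; `Φ` ANY map with block means `w` and the `φ⁴` sitewise equation at every `w` — it
exists uniquely by (93)): at every `wt`, `∃ Dt H2` with the two response letters (`u′ = 3g t² + m`), `HasFDerivAt Φ Dt wt`,
`HasFDerivAt (fderiv (S_{φ⁴} ∘ Φ)) H2 wt`, the graph formula, symmetry, `(min(2,a) + m)·Σ_x (Dt k x)² ≤ H2 k k` and
`(min(2,a) + m)·((n+1)^d·Σ_y k y²) ≤ H2 k k` — no coupling window, no field window. [folklore] -/
theorem phiFour_effectiveAction_hessian_global (n : ℕ) (a : ℝ) (s : ℕ) [NeZero s]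
    {Dop Aop : lp (fun _ : X d => ℝ) ∞ →L[ℝ] lp (fun _ : X d => ℝ) ∞}
    (hD : ∀ (f : lp (fun _ : X d => ℝ) ∞) (y : X d), Dop f y = (((n : ℝ) + 1) ^ d)⁻¹ * ∑ p ∈ B n y, f p)
    (hA : ∀ (f : lp (fun _ : X d => ℝ) ∞) (p : X d), Aop f p = ∑ r ∈ nbhd n p, AX n a p r * f r)
    {Ef : (Site d ((n + 1) * s) → ℝ) →L[ℝ] lp (fun _ : X d => ℝ) ∞}
    (hEf : ∀ (g : Site d ((n + 1) * s) → ℝ) (q : X d), Ef g q = g (siteOf d ((n + 1) * s) q))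
    {Rf : lp (fun _ : X d => ℝ) ∞ →L[ℝ] (Site d ((n + 1) * s) → ℝ)}
    (hRf : ∀ (h : lp (fun _ : X d => ℝ) ∞) (x : Site d ((n + 1) * s)), Rf h x = h (windowMap d ((n + 1) * s) x))
    {Rc : lp (fun _ : X d => ℝ) ∞ →L[ℝ] (Site d s → ℝ)}
    (hRc : ∀ (h : lp (fun _ : X d => ℝ) ∞) (x : Site d s), Rc h x = h (windowMap d s x))
    {g m : ℝ} (hg : 0 ≤ g) (hm : -m < min 2 a)
    (Φ : (Site d s → ℝ) → (Site d ((n + 1) * s) → ℝ))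
    (hΦQ : ∀ w : Site d s → ℝ, ((Rc.comp Dop).comp Ef) (Φ w) = w)
    (hΦeq : ∀ (w : Site d s → ℝ) (p : X d), Aop (Ef (Φ w)) p + (g * (Ef (Φ w) p) ^ 3 + m * Ef (Φ w) p)
      = (((n : ℝ) + 1) ^ d)⁻¹ * ∑ p' ∈ B n (blk n p), (Aop (Ef (Φ w)) p' + (g * (Ef (Φ w) p') ^ 3 + m * Ef (Φ w) p')))
    (wt : Site d s → ℝ) :
    ∃ (Dt : (Site d s → ℝ) →L[ℝ] (Site d ((n + 1) * s) → ℝ)) (H2 : (Site d s → ℝ) →L[ℝ] (Site d s → ℝ) →L[ℝ] ℝ),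
      (∀ k : Site d s → ℝ, ((Rc.comp Dop).comp Ef) (Dt k) = k) ∧
      (∀ (k : Site d s → ℝ) (κ' : Site d ((n + 1) * s) → ℝ), ((Rc.comp Dop).comp Ef) κ' = 0 →
        ∑ x, (((Rf.comp Aop).comp Ef) (Dt k) x + (3 * g * (Φ wt x) ^ 2 + m) * Dt k x) * κ' x = 0) ∧
      HasFDerivAt Φ Dt wt ∧
      HasFDerivAt (fderiv ℝ ((fun φ : Site d ((n + 1) * s) → ℝ =>
          (1 / 2 : ℝ) * ∑ x, φ x * ((Rf.comp Aop).comp Ef) φ x + ∑ x, (g / 4 * (φ x) ^ 4 + m / 2 * (φ x) ^ 2)) ∘ Φ)) H2 wt ∧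
      (∀ k k' : Site d s → ℝ,
        H2 k k' = ∑ x, (((Rf.comp Aop).comp Ef) (Dt k) x + (3 * g * (Φ wt x) ^ 2 + m) * Dt k x) * Dt k' x) ∧
      (∀ k k' : Site d s → ℝ, H2 k k' = H2 k' k) ∧
      (∀ k : Site d s → ℝ, (min 2 a + m) * ∑ x, Dt k x ^ 2 ≤ H2 k k) ∧
      (∀ k : Site d s → ℝ, (min 2 a + m) * (((n : ℝ) + 1) ^ d * ∑ y, k y ^ 2) ≤ H2 k k) := by
  have h := torus_effectiveAction_hessian_global n a s hD hA (v := fun t => g / 4 * t ^ 4 + m / 2 * t ^ 2)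
    (u := fun t => g * t ^ 3 + m * t) (u' := fun t => 3 * g * t ^ 2 + m) (hasDerivAt_phiFour_potential g m)
    (hasDerivAt_phiFour g m) (lam := -m) (fun t => by nlinarith [sq_nonneg t]) (by simpa using hm) hEf hRf hRc Φ hΦQ hΦeq wt
  simp only [sub_neg_eq_add] at h
  exact h

end Summit.QuantumFields.BalabanUV.T4Continuum.NE7b.SupTorusEffectiveActionHessianGlobal

end
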